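import Literature.NumberTheory.IwasawaTheory.ClassicalMuVanishesSplitCartanFiveDescentAbelianSteps
import Literature.NumberTheory.IwasawaTheory.ClassicalMuVanishesDivisionFieldThree
import Literature.NumberTheory.SerreUniformity.SplitCartan
import Mathlib.GroupTheory.PGroup
import HarnessLib

set_option autoImplicit false

/-!
# `μ = 0` for `ℚ(E[5])_cyc` from a mod-5 image in the index-2 subgroup `G₁₆ = ⟨(0 1; 2 0), diag(1,4)⟩ ≅ M₁₆` of `C_s⁺(5)` WITHOUT
# Ferrero–Washington: `ℚ(P₁)` plus the four abelian leaves `K″ = L^{⟨a⁴, s⟩}`, `Z = L^{⟨a²s⟩} = ℚ(ζ₅)`, `L^{⟨a⟩}`, `L^{⟨a², as⟩}`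

Topic `NumberTheory/IwasawaTheory` (namespace = path).  THEOREM-ONLY file (no definition, no named fact, no `sorry`); cell `bsd-potss`,
seat `bsd-potss-k8t-c4` g24 (supports the KT U₀-ns node stmt-BirchSwinnertonDyer-19202 → 19982 and the Conj-A items 19413 / 19916 at the
row 446400hu1 @ 5; closes nothing).  Twin of `ClassicalMuVanishesSplitCartanFiveIndexTwo` (k8t-c4 g18: ONE leaf `ℚ(P₁) = L^{⟨s⟩}` modulo
Ferrero–Washington, via `classicalMuVanishes_of_isCyclotomic_of_kuroda_rat` with `z = a⁴ = −1`, `b = s`) with the named fact REMOVED.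
CHARACTER COUNT on `G₁₆ = ⟨a, s⟩ ≅ M₁₆` (`a = (0 1; 2 0)` of order `8`, `s = diag(1,4)`, `s a s⁻¹ = a⁵`; `8` linear characters through
`G₁₆/⟨a⁴⟩ ≅ C₄ × C₂`, two `2`-dimensional ones): `ℚ(P₁)` sees both `2`-dimensional characters and the four linear ones trivial on `s̄`;
Ferrero–Washington supplied the other four, carried by the cyclic quartic `K″ = L^{⟨a⁴, s⟩}` (`⊇ L^{⟨a², s⟩} = ℚ(√5)`), by
`Z = L^{⟨a²s⟩} = L^{ker det} = ℚ(ζ₅)` and by the two quadratic fields `L^{⟨a⟩}`, `L^{⟨a², as⟩}` (for 446400hu1: `ℚ(√−3)`, `ℚ(√−15)`;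
maximal abelian subfield `L^{⟨a⁴⟩} = ℚ(ζ₁₅)`).  Road (Kuroda EQUALITIES at every layer, no growth theorem, no named fact):
(B′) `L^{⟨a²⟩}` (`a²` = the scalar `2`, central) from the Klein four `{1, ā, s̄, ās̄}` of `Gal(L^{⟨a²⟩}/ℚ)`: leaves `L^{⟨a⟩}`, `L^{⟨a²,s⟩} ⊆ L^{⟨s⟩}`,
`L^{⟨a², as⟩}`; (A′) `L^{⟨a⁴⟩}` from the Klein four `{1, ā², s̄, ā²s̄}` of `Gal(L^{⟨a⁴⟩}/ℚ)`: leaves `L^{⟨a²⟩}`, `K″`, `Z`; then the Kuroda step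
`classicalMuVanishes_of_isCyclotomic_of_kuroda_conj` (`z = a⁴`, `b = s`, conjugator `a`).  §0 repeats g18's finite facts about the sixteen
matrices (private there) verbatim.

References: [Lemmermeyer1994] §1 (Kuroda's class number formula, odd part); [Washington1997] §13.1; [Serre1972] §2.2 (split Cartan subgroups
and their normalisers); [MilneFT2022] Ch. 3.
-/

noncomputable section

open scoped NumberField Matrix

open Field IntermediateField WeierstrassCurve Literature.NumberTheory.EllipticCurves Literature.NumberTheory.GaloisRepresentations
  Literature.NumberTheory.SerreUniformity

namespace Literature.NumberTheory.IwasawaTheory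

/-! ### §0 Finite facts about `G₁₆ = ⟨(0 1; 2 0), diag(1,4)⟩ ⊂ C_s⁺(5)` (by `decide`) -/

section Matrices

/-- An element `M ∈ splitCartanNormalizer 5` with `M₁₁ ∈ {M₀₀, 4M₀₀}` and `M₁₀ ∈ {2M₀₁, 3M₀₁}` has one of the four shapes `c·1`,
`c·diag(1,4)`, `c·(0 1; 2 0)`, `c·(0 1; 3 0)` with `c ≠ 0`. [folklore] -/
private theorem shape_of_mem_indexTwo₆ {M : Matrix (Fin 2) (Fin 2) (ZMod 5)} (hM : M ∈ splitCartanNormalizer 5)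
    (hd : M 1 1 = M 0 0 ∨ M 1 1 = 4 * M 0 0) (ha : M 1 0 = 2 * M 0 1 ∨ M 1 0 = 3 * M 0 1) :
    ∃ c : ZMod 5, c ≠ 0 ∧ (M = !![c, 0; 0, c] ∨ M = !![c, 0; 0, 4 * c] ∨ M = !![0, c; 2 * c, 0] ∨ M = !![0, c; 3 * c, 0]) := by
  obtain ⟨hdet, h | h⟩ := hM
  · refine ⟨M 0 0, ?_, ?_⟩
    · intro h0
      apply hdet
      simp [Matrix.det_fin_two, h.1, h.2, h0]
    · rcases hd with hd | hd
      · exact Or.inl (Matrix.ext fun i j => by fin_cases i <;> fin_cases j <;> simp [h.1, h.2, hd])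
      · exact Or.inr (Or.inl (Matrix.ext fun i j => by fin_cases i <;> fin_cases j <;> simp [h.1, h.2, hd]))
  · refine ⟨M 0 1, ?_, ?_⟩
    · intro h0
      apply hdet
      simp [Matrix.det_fin_two, h.1, h.2, h0]
    · rcases ha with ha | ha
      · exact Or.inr (Or.inr (Or.inl (Matrix.ext fun i j => by fin_cases i <;> fin_cases j <;> simp [h.1, h.2, ha])))
      · exact Or.inr (Or.inr (Or.inr (Matrix.ext fun i j => by fin_cases i <;> fin_cases j <;> simp [h.1, h.2, ha])))

/-- In `G₁₆` every pair of elements commutes up to the central sign `−1 = diag(4,4)`: `M N = N M` or `M N = (−1)·(N M)` — the sixteen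
shape combinations, parametrised by the two scalars. [folklore] -/
private theorem comm_shapes₆ : ∀ c c' : ZMod 5,
    ((!![c, 0; 0, c] : Matrix (Fin 2) (Fin 2) (ZMod 5)) * !![c', 0; 0, c'] = !![c', 0; 0, c'] * !![c, 0; 0, c]) ∧
    ((!![c, 0; 0, c] : Matrix (Fin 2) (Fin 2) (ZMod 5)) * !![c', 0; 0, 4 * c'] = !![c', 0; 0, 4 * c'] * !![c, 0; 0, c]) ∧
    ((!![c, 0; 0, c] : Matrix (Fin 2) (Fin 2) (ZMod 5)) * !![0, c'; 2 * c', 0] = !![0, c'; 2 * c', 0] * !![c, 0; 0, c]) ∧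
    ((!![c, 0; 0, c] : Matrix (Fin 2) (Fin 2) (ZMod 5)) * !![0, c'; 3 * c', 0] = !![0, c'; 3 * c', 0] * !![c, 0; 0, c]) ∧
    ((!![c, 0; 0, 4 * c] : Matrix (Fin 2) (Fin 2) (ZMod 5)) * !![c', 0; 0, c'] = !![c', 0; 0, c'] * !![c, 0; 0, 4 * c]) ∧
    ((!![c, 0; 0, 4 * c] : Matrix (Fin 2) (Fin 2) (ZMod 5)) * !![c', 0; 0, 4 * c'] = !![c', 0; 0, 4 * c'] * !![c, 0; 0, 4 * c]) ∧
    ((!![c, 0; 0, 4 * c] : Matrix (Fin 2) (Fin 2) (ZMod 5)) * !![0, c'; 2 * c', 0] =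
      !![4, 0; 0, 4] * (!![0, c'; 2 * c', 0] * !![c, 0; 0, 4 * c])) ∧
    ((!![c, 0; 0, 4 * c] : Matrix (Fin 2) (Fin 2) (ZMod 5)) * !![0, c'; 3 * c', 0] =
      !![4, 0; 0, 4] * (!![0, c'; 3 * c', 0] * !![c, 0; 0, 4 * c])) ∧
    ((!![0, c; 2 * c, 0] : Matrix (Fin 2) (Fin 2) (ZMod 5)) * !![c', 0; 0, c'] = !![c', 0; 0, c'] * !![0, c; 2 * c, 0]) ∧
    ((!![0, c; 2 * c, 0] : Matrix (Fin 2) (Fin 2) (ZMod 5)) * !![c', 0; 0, 4 * c'] =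
      !![4, 0; 0, 4] * (!![c', 0; 0, 4 * c'] * !![0, c; 2 * c, 0])) ∧
    ((!![0, c; 2 * c, 0] : Matrix (Fin 2) (Fin 2) (ZMod 5)) * !![0, c'; 2 * c', 0] = !![0, c'; 2 * c', 0] * !![0, c; 2 * c, 0]) ∧
    ((!![0, c; 2 * c, 0] : Matrix (Fin 2) (Fin 2) (ZMod 5)) * !![0, c'; 3 * c', 0] =
      !![4, 0; 0, 4] * (!![0, c'; 3 * c', 0] * !![0, c; 2 * c, 0])) ∧
    ((!![0, c; 3 * c, 0] : Matrix (Fin 2) (Fin 2) (ZMod 5)) * !![c', 0; 0, c'] = !![c', 0; 0, c'] * !![0, c; 3 * c, 0]) ∧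
    ((!![0, c; 3 * c, 0] : Matrix (Fin 2) (Fin 2) (ZMod 5)) * !![c', 0; 0, 4 * c'] =
      !![4, 0; 0, 4] * (!![c', 0; 0, 4 * c'] * !![0, c; 3 * c, 0])) ∧
    ((!![0, c; 3 * c, 0] : Matrix (Fin 2) (Fin 2) (ZMod 5)) * !![0, c'; 2 * c', 0] =
      !![4, 0; 0, 4] * (!![0, c'; 2 * c', 0] * !![0, c; 3 * c, 0])) ∧
    ((!![0, c; 3 * c, 0] : Matrix (Fin 2) (Fin 2) (ZMod 5)) * !![0, c'; 3 * c', 0] = !![0, c'; 3 * c', 0] * !![0, c; 3 * c, 0]) := by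
  decide

/-- `M N = N M` or `M N = (−1)·(N M)` for `M, N ∈ G₁₆`. [folklore] -/
private theorem mul_eq_or_of_mem_indexTwo₆ {M N : Matrix (Fin 2) (Fin 2) (ZMod 5)} (hM : M ∈ splitCartanNormalizer 5)
    (hMd : M 1 1 = M 0 0 ∨ M 1 1 = 4 * M 0 0) (hMa : M 1 0 = 2 * M 0 1 ∨ M 1 0 = 3 * M 0 1) (hN : N ∈ splitCartanNormalizer 5)
    (hNd : N 1 1 = N 0 0 ∨ N 1 1 = 4 * N 0 0) (hNa : N 1 0 = 2 * N 0 1 ∨ N 1 0 = 3 * N 0 1) :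
    M * N = N * M ∨ M * N = !![4, 0; 0, 4] * (N * M) := by
  obtain ⟨c, -, hc⟩ := shape_of_mem_indexTwo₆ hM hMd hMa
  obtain ⟨c', -, hc'⟩ := shape_of_mem_indexTwo₆ hN hNd hNa
  obtain ⟨f11, f12, f13, f14, f21, f22, f23, f24, f31, f32, f33, f34, f41, f42, f43, f44⟩ := comm_shapes₆ c c'
  rcases hc with rfl | rfl | rfl | rfl <;> rcases hc' with rfl | rfl | rfl | rfl
  exacts [Or.inl f11, Or.inl f12, Or.inl f13, Or.inl f14, Or.inl f21, Or.inl f22, Or.inr f23, Or.inr f24, Or.inl f31, Or.inr f32,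
    Or.inl f33, Or.inr f34, Or.inl f41, Or.inr f42, Or.inr f43, Or.inl f44]

/-- Every element of `G₁₆` has order dividing `8` (shapes). [folklore] -/
private theorem pow_eight_shapes₆ : ∀ c : ZMod 5, c ≠ 0 →
    (!![c, 0; 0, c] : Matrix (Fin 2) (Fin 2) (ZMod 5)) ^ 8 = 1 ∧ (!![c, 0; 0, 4 * c] : Matrix (Fin 2) (Fin 2) (ZMod 5)) ^ 8 = 1 ∧
      (!![0, c; 2 * c, 0] : Matrix (Fin 2) (Fin 2) (ZMod 5)) ^ 8 = 1 ∧ (!![0, c; 3 * c, 0] : Matrix (Fin 2) (Fin 2) (ZMod 5)) ^ 8 = 1 := by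
  decide

/-- Every element of `G₁₆` has order dividing `8`. [folklore] -/
private theorem pow_eight_eq_one_of_mem_indexTwo₆ {M : Matrix (Fin 2) (Fin 2) (ZMod 5)} (hM : M ∈ splitCartanNormalizer 5)
    (hMd : M 1 1 = M 0 0 ∨ M 1 1 = 4 * M 0 0) (hMa : M 1 0 = 2 * M 0 1 ∨ M 1 0 = 3 * M 0 1) : M ^ 8 = 1 := by
  obtain ⟨c, hc0, hc⟩ := shape_of_mem_indexTwo₆ hM hMd hMa
  obtain ⟨h1, h2, h3, h4⟩ := pow_eight_shapes₆ c hc0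
  rcases hc with rfl | rfl | rfl | rfl
  exacts [h1, h2, h3, h4]

/-- The relations among `A = (0 1; 2 0)` and `S = diag(1,4)` used below: `A⁴ = −1`, `(−1)² = 1`, `S² = 1`, `(−1)S = S(−1)`,
`A S = (−1) S A`, `A² = 2`, `(A²S)² = −1`. [folklore] -/
private theorem as_facts₆ :
    (!![0, 1; 2, 0] : Matrix (Fin 2) (Fin 2) (ZMod 5)) * !![0, 1; 2, 0] * (!![0, 1; 2, 0] * !![0, 1; 2, 0]) = !![4, 0; 0, 4] ∧
    (!![4, 0; 0, 4] : Matrix (Fin 2) (Fin 2) (ZMod 5)) * !![4, 0; 0, 4] = 1 ∧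
    (!![1, 0; 0, 4] : Matrix (Fin 2) (Fin 2) (ZMod 5)) * !![1, 0; 0, 4] = 1 ∧
    (!![4, 0; 0, 4] : Matrix (Fin 2) (Fin 2) (ZMod 5)) * !![1, 0; 0, 4] = !![1, 0; 0, 4] * !![4, 0; 0, 4] ∧
    (!![0, 1; 2, 0] : Matrix (Fin 2) (Fin 2) (ZMod 5)) * !![1, 0; 0, 4] = !![4, 0; 0, 4] * !![1, 0; 0, 4] * !![0, 1; 2, 0] ∧
    (!![0, 1; 2, 0] : Matrix (Fin 2) (Fin 2) (ZMod 5)) * !![0, 1; 2, 0] = !![2, 0; 0, 2] := by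
  decide

/-- The scalar `2 = A²` is central in `M₂(𝔽₅)`. [folklore] -/
private theorem two_scalar_comm₆ (M : Matrix (Fin 2) (Fin 2) (ZMod 5)) : M * !![2, 0; 0, 2] = !![2, 0; 0, 2] * M := by
  ext i j
  fin_cases i <;> fin_cases j <;> simp [Matrix.mul_apply, Fin.sum_univ_two] <;> ring

end Matrices

/-! ### §1 The bridge (group level), Ferrero–Washington-free -/

set_option maxHeartbeats 800000 in
/-- **`μ = 0` for the cyclotomic `ℤ_5`-tower of `L` from a faithful `G₁₆`-valued representation of `Gal(L/ℚ)` — NO named fact; fixed-field form.**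
`L/ℚ` finite Galois; `ρ : Gal(L/ℚ) →* M₂(𝔽₅)` injective with every `ρ g` in `splitCartanNormalizer 5` and of shape `c·1`, `c·diag(1,4)`, `c·(0 1; 2 0)`
or `c·(0 1; 3 0)` (`himg`); `s, a ∈ Gal(L/ℚ)` with `ρ s = diag(1,4)`, `ρ a = (0 1; 2 0)`.  If `μ = 0` holds for every cyclotomic `ℤ_5`-extension of
the FIVE fixed fields `L^{⟨s⟩}` (`= ℚ(P₁)`, 8), `L^{⟨a⁴, s⟩}` (`K″`, cyclic quartic), `L^{⟨a²s⟩}` (`= ℚ(ζ₅)`), `L^{⟨a⟩}` and `L^{⟨a², as⟩}` (quadratic),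
then for every cyclotomic `ℤ_5`-extension of `L`.  Road: (B′) Kuroda for `{1, ā, s̄, ās̄}` in `Gal(L^{⟨a²⟩}/ℚ)` (`a²` central), (A′) Kuroda for
`{1, ā², s̄, ā²s̄}` in `Gal(L^{⟨a⁴⟩}/ℚ)` (`⟨a⁴⟩ ⊇ [G,G]`), then `…_of_kuroda_conj` with `z = a⁴`, `b = s`, `a s a⁻¹ = z s`.  `Gal(L/ℚ)` is a `2`-group
so `5 ∤ [L:ℚ]`. [cite: Lemmermeyer1994, §1 (Kuroda's class number formula, odd part)] [cite: Washington1997, §13.1]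
[cite: Serre1972, §2.2 (split Cartan subgroups and their normalisers)] [cite: MilneFT2022, Ch. 3] -/
theorem classicalMuVanishes_of_isCyclotomic_of_splitCartanIndexTwo_five_fixedField_abelian
    [Fact (Nat.Prime 5)] (L : Type) [Field L] [NumberField L] [IsGalois ℚ L]
    (ρ : (L ≃ₐ[ℚ] L) →* Matrix (Fin 2) (Fin 2) (ZMod 5)) (hρ : Function.Injective ρ)
    (himg : ∀ g, ρ g ∈ splitCartanNormalizer 5 ∧ ((ρ g) 1 1 = (ρ g) 0 0 ∨ (ρ g) 1 1 = 4 * (ρ g) 0 0) ∧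
      ((ρ g) 1 0 = 2 * (ρ g) 0 1 ∨ (ρ g) 1 0 = 3 * (ρ g) 0 1))
    {s a : L ≃ₐ[ℚ] L} (hs : ρ s = !![1, 0; 0, 4]) (ha : ρ a = !![0, 1; 2, 0])
    (hμP : ∀ κE : ZpExtension ↥(fixedField (Subgroup.zpowers s)) 5, κE.IsCyclotomic → ClassicalMuVanishes κE)
    (hμK : ∀ κE : ZpExtension ↥(fixedField (Subgroup.zpowers (a * a * (a * a)) ⊔ Subgroup.zpowers s)) 5,
      κE.IsCyclotomic → ClassicalMuVanishes κE)
    (hμZ : ∀ κE : ZpExtension ↥(fixedField (Subgroup.zpowers (a * a * s))) 5, κE.IsCyclotomic → ClassicalMuVanishes κE)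
    (hμQ : ∀ κE : ZpExtension ↥(fixedField (Subgroup.zpowers a)) 5, κE.IsCyclotomic → ClassicalMuVanishes κE)
    (hμR : ∀ κE : ZpExtension ↥(fixedField (Subgroup.zpowers (a * a) ⊔ Subgroup.zpowers (a * s))) 5,
      κE.IsCyclotomic → ClassicalMuVanishes κE)
    (κL : ZpExtension L 5) (hκL : κL.IsCyclotomic) : ClassicalMuVanishes κL := by
  obtain ⟨fA4, fZ2, fS2, fZS, fAS, fA2⟩ := as_facts₆
  have hp5 : ¬ 5 ∣ Module.finrank ℚ L := by
    haveI : Fact (Nat.Prime 2) := ⟨Nat.prime_two⟩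
    have h2 : IsPGroup 2 (L ≃ₐ[ℚ] L) := fun g => ⟨3, hρ (by
      obtain ⟨hg, hgd, hga⟩ := himg g
      rw [map_pow, map_one]; exact pow_eight_eq_one_of_mem_indexTwo₆ hg hgd hga)⟩
    obtain ⟨n, hn⟩ := IsPGroup.iff_card.mp h2
    rw [← IsGalois.card_aut_eq_finrank, hn]
    intro h
    have h5 : (5 : ℕ) ∣ 2 := (Nat.prime_five).dvd_of_dvd_pow h
    omega
  -- the central involution `z = a⁴`, `ρ z = −1`; the central element `a²`, `ρ a² = 2`
  have hρz : ρ (a * a * (a * a)) = !![4, 0; 0, 4] := by simp only [map_mul, ha]; exact fA4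
  have hρa2 : ρ (a * a) = !![2, 0; 0, 2] := by rw [map_mul, ha]; exact fA2
  have hz : a * a * (a * a) * (a * a * (a * a)) = 1 := hρ (by rw [map_mul, hρz, map_one]; exact fZ2)
  have hb : s * s = 1 := hρ (by rw [map_mul, hs, map_one]; exact fS2)
  have hzb : a * a * (a * a) * s = s * (a * a * (a * a)) :=
    hρ (by rw [map_mul ρ (a * a * (a * a)) s, map_mul ρ s (a * a * (a * a)), hρz, hs]; exact fZS)
  have haS : a * s * a⁻¹ = a * a * (a * a) * s := by
    rw [mul_inv_eq_iff_eq_mul]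
    exact hρ (by rw [map_mul ρ a s, map_mul ρ (a * a * (a * a) * s) a, map_mul ρ (a * a * (a * a)) s, ha, hs, hρz]; exact fAS)
  have hconj : ∃ g : L ≃ₐ[ℚ] L, g * s * g⁻¹ = a * a * (a * a) * s := ⟨a, haS⟩
  have ha2c : ∀ g : L ≃ₐ[ℚ] L, g * (a * a) = a * a * g := fun g =>
    hρ (by rw [map_mul ρ g (a * a), map_mul ρ (a * a) g, hρa2]; exact two_scalar_comm₆ _)
  -- commutators in `⟨z⟩`
  have hcomm : ∀ g h : L ≃ₐ[ℚ] L, g * h * g⁻¹ * h⁻¹ ∈ Subgroup.zpowers (a * a * (a * a)) := by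
    intro g h
    have key : ∀ x : L ≃ₐ[ℚ] L, g * h = x * (h * g) → g * h * g⁻¹ * h⁻¹ = x := fun x hx => by
      rw [show g * h * g⁻¹ * h⁻¹ = (g * h) * (h * g)⁻¹ by group, hx]; group
    obtain ⟨hg, hgd, hga⟩ := himg g
    obtain ⟨hh, hhd, hha⟩ := himg h
    rcases mul_eq_or_of_mem_indexTwo₆ hg hgd hga hh hhd hha with h1 | h1
    · rw [key 1 (by rw [one_mul]; exact hρ (by rw [map_mul ρ g h, map_mul ρ h g]; exact h1))]
      exact Subgroup.one_mem _
    · rw [key (a * a * (a * a)) (hρ (by rw [map_mul ρ g h, map_mul ρ (a * a * (a * a)) (h * g), map_mul ρ h g, hρz]; exact h1))]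
      exact Subgroup.mem_zpowers _
  -- (B′) `μ(L^{⟨a²⟩}) = 0`: Klein four `{1, ā, s̄, ā s̄}` of `Gal(L^{⟨a²⟩}/ℚ)`
  obtain ⟨N₂, hN₂⟩ : ∃ N₂ : Subgroup (L ≃ₐ[ℚ] L), N₂ = Subgroup.zpowers (a * a) := ⟨_, rfl⟩
  haveI hN₂N : N₂.Normal := by
    rw [hN₂]
    refine ⟨fun h hh g => ?_⟩
    obtain ⟨k, rfl⟩ := Subgroup.mem_zpowers_iff.mp hh
    have hc : Commute g (a * a) := ha2c g
    rw [(hc.zpow_right k).eq, mul_inv_cancel_right]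
    exact hh
  have haaN₂ : a * a ∈ N₂ := hN₂ ▸ Subgroup.mem_zpowers _
  haveI : IsGalois ℚ ↥(fixedField N₂) := IsGalois.of_fixedField_normal_subgroup N₂
  have hp₂ : ¬ 5 ∣ Module.finrank ℚ ↥(fixedField N₂) := not_dvd_finrank_intermediateField_rat hp5 _
  obtain ⟨π, hπ⟩ : ∃ π : (L ≃ₐ[ℚ] L) →* (↥(fixedField N₂) ≃ₐ[ℚ] ↥(fixedField N₂)),
      π = AlgEquiv.restrictNormalHom ↥(fixedField N₂) := ⟨_, rfl⟩
  have hker : ∀ g, π g = 1 ↔ g ∈ N₂ := by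
    intro g
    have h1 := IntermediateField.restrictNormalHom_ker (K := ℚ) (L := L) (fixedField N₂)
    rw [IntermediateField.fixingSubgroup_fixedField] at h1
    rw [← MonoidHom.mem_ker, hπ]
    exact SetLike.ext_iff.mp h1 g
  have hN₂π : N₂.map π = ⊥ := by
    rw [Subgroup.map_eq_bot_iff]
    intro g hg
    rw [MonoidHom.mem_ker]
    exact (hker g).mpr hg
  have hz₂ : π a * π a = 1 := by rw [← map_mul, hker]; exact haaN₂
  have hb₂ : π s * π s = 1 := by rw [← map_mul, hb, map_one]
  have hzb₂ : π a * π s = π s * π a := by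
    have h1 : π (a * s * a⁻¹ * s⁻¹) = 1 := by
      rw [hker]
      have h2 : a * s * a⁻¹ * s⁻¹ = a * a * (a * a) := by rw [haS]; group
      rw [h2]
      exact N₂.mul_mem haaN₂ haaN₂
    rw [map_mul, map_mul, map_mul, map_inv, map_inv, mul_inv_eq_one, mul_inv_eq_iff_eq_mul] at h1
    exact h1
  have hmapQa : (N₂ ⊔ Subgroup.zpowers a).map π = Subgroup.zpowers (π a) := by
    rw [Subgroup.map_sup, MonoidHom.map_zpowers, hN₂π, bot_sup_eq]
  have hμ₂a : ∀ κE : ZpExtension ↥(fixedField (Subgroup.zpowers (π a))) 5, κE.IsCyclotomic → ClassicalMuVanishes κE :=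
    forall_classicalMuVanishes_fixedField_quotient hp5 N₂ _ le_sup_left π hπ _ hmapQa
      (forall_classicalMuVanishes_fixedField_of_le hp5 le_sup_right hμQ)
  have hmapS : (N₂ ⊔ Subgroup.zpowers s).map π = Subgroup.zpowers (π s) := by
    rw [Subgroup.map_sup, MonoidHom.map_zpowers, hN₂π, bot_sup_eq]
  have hμ₂b : ∀ κE : ZpExtension ↥(fixedField (Subgroup.zpowers (π s))) 5, κE.IsCyclotomic → ClassicalMuVanishes κE :=
    forall_classicalMuVanishes_fixedField_quotient hp5 N₂ _ le_sup_left π hπ _ hmapS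
      (forall_classicalMuVanishes_fixedField_of_le hp5 le_sup_right hμP)
  have hmapAS : (N₂ ⊔ Subgroup.zpowers (a * s)).map π = Subgroup.zpowers (π a * π s) := by
    rw [Subgroup.map_sup, MonoidHom.map_zpowers, hN₂π, bot_sup_eq, map_mul]
  have hμ₂c : ∀ κE : ZpExtension ↥(fixedField (Subgroup.zpowers (π a * π s))) 5, κE.IsCyclotomic → ClassicalMuVanishes κE :=
    forall_classicalMuVanishes_fixedField_quotient hp5 N₂ _ le_sup_left π hπ _ hmapAS
      (forall_classicalMuVanishes_fixedField_of_eq hp5 (by rw [hN₂]) hμR)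
  have hmapD : (N₂ ⊔ (Subgroup.zpowers a ⊔ Subgroup.zpowers s)).map π = Subgroup.closure {π a, π s} := by
    rw [Subgroup.map_sup, Subgroup.map_sup, MonoidHom.map_zpowers, MonoidHom.map_zpowers, hN₂π, bot_sup_eq, Set.insert_eq,
      Subgroup.closure_union, ← Subgroup.zpowers_eq_closure, ← Subgroup.zpowers_eq_closure]
  have hμ₂d : ∀ κE : ZpExtension ↥(fixedField (Subgroup.closure {π a, π s})) 5, κE.IsCyclotomic → ClassicalMuVanishes κE :=
    forall_classicalMuVanishes_fixedField_quotient hp5 N₂ _ le_sup_left π hπ _ hmapD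
      (forall_classicalMuVanishes_fixedField_of_le hp5 (le_sup_right.trans le_sup_right) hμP)
  have hμB : ∀ κE : ZpExtension ↥(fixedField N₂) 5, κE.IsCyclotomic → ClassicalMuVanishes κE :=
    classicalMuVanishes_of_isCyclotomic_of_biquadratic (by decide) ↥(fixedField N₂) hp₂ hz₂ hb₂ hzb₂ hμ₂a hμ₂b hμ₂c hμ₂d
  -- (A′) `μ(L^{⟨a⁴⟩}) = 0`: Klein four `{1, ā², s̄, ā² s̄}` of `Gal(L^{⟨a⁴⟩}/ℚ)`
  obtain ⟨N₄, hN₄⟩ : ∃ N₄ : Subgroup (L ≃ₐ[ℚ] L), N₄ = Subgroup.zpowers (a * a * (a * a)) := ⟨_, rfl⟩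
  have hcommN : ∀ g h : L ≃ₐ[ℚ] L, g * h * g⁻¹ * h⁻¹ ∈ N₄ := fun g h => hN₄ ▸ hcomm g h
  haveI hN₄N : N₄.Normal := normal_of_forall_commutator_mem N₄ hcommN
  have hzN₄ : a * a * (a * a) ∈ N₄ := hN₄ ▸ Subgroup.mem_zpowers _
  haveI : IsGalois ℚ ↥(fixedField N₄) := IsGalois.of_fixedField_normal_subgroup N₄
  have hp₄ : ¬ 5 ∣ Module.finrank ℚ ↥(fixedField N₄) := not_dvd_finrank_intermediateField_rat hp5 _
  obtain ⟨ϖ, hϖ⟩ : ∃ ϖ : (L ≃ₐ[ℚ] L) →* (↥(fixedField N₄) ≃ₐ[ℚ] ↥(fixedField N₄)),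
      ϖ = AlgEquiv.restrictNormalHom ↥(fixedField N₄) := ⟨_, rfl⟩
  have hker₄ : ∀ g, ϖ g = 1 ↔ g ∈ N₄ := by
    intro g
    have h1 := IntermediateField.restrictNormalHom_ker (K := ℚ) (L := L) (fixedField N₄)
    rw [IntermediateField.fixingSubgroup_fixedField] at h1
    rw [← MonoidHom.mem_ker, hϖ]
    exact SetLike.ext_iff.mp h1 g
  have hN₄ϖ : N₄.map ϖ = ⊥ := by
    rw [Subgroup.map_eq_bot_iff]
    intro g hg
    rw [MonoidHom.mem_ker]
    exact (hker₄ g).mpr hg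
  have hz₄ : ϖ (a * a) * ϖ (a * a) = 1 := by rw [← map_mul, hker₄]; exact hzN₄
  have hb₄ : ϖ s * ϖ s = 1 := by rw [← map_mul, hb, map_one]
  have hzb₄ : ϖ (a * a) * ϖ s = ϖ s * ϖ (a * a) := by rw [← map_mul, ← map_mul, (ha2c s).symm]
  have hmap₄a : (N₄ ⊔ Subgroup.zpowers (a * a)).map ϖ = Subgroup.zpowers (ϖ (a * a)) := by
    rw [Subgroup.map_sup, MonoidHom.map_zpowers, hN₄ϖ, bot_sup_eq]
  have hμ₄a : ∀ κE : ZpExtension ↥(fixedField (Subgroup.zpowers (ϖ (a * a)))) 5, κE.IsCyclotomic → ClassicalMuVanishes κE :=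
    forall_classicalMuVanishes_fixedField_quotient hp5 N₄ _ le_sup_left ϖ hϖ _ hmap₄a
      (forall_classicalMuVanishes_fixedField_of_le hp5 (hN₂ ▸ le_sup_right) hμB)
  have hmap₄b : (N₄ ⊔ Subgroup.zpowers s).map ϖ = Subgroup.zpowers (ϖ s) := by
    rw [Subgroup.map_sup, MonoidHom.map_zpowers, hN₄ϖ, bot_sup_eq]
  have hμ₄b : ∀ κE : ZpExtension ↥(fixedField (Subgroup.zpowers (ϖ s))) 5, κE.IsCyclotomic → ClassicalMuVanishes κE :=
    forall_classicalMuVanishes_fixedField_quotient hp5 N₄ _ le_sup_left ϖ hϖ _ hmap₄b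
      (forall_classicalMuVanishes_fixedField_of_eq hp5 (by rw [hN₄]) hμK)
  have hmap₄c : (N₄ ⊔ Subgroup.zpowers (a * a * s)).map ϖ = Subgroup.zpowers (ϖ (a * a) * ϖ s) := by
    rw [Subgroup.map_sup, MonoidHom.map_zpowers, hN₄ϖ, bot_sup_eq, map_mul]
  have hμ₄c : ∀ κE : ZpExtension ↥(fixedField (Subgroup.zpowers (ϖ (a * a) * ϖ s))) 5,
      κE.IsCyclotomic → ClassicalMuVanishes κE :=
    forall_classicalMuVanishes_fixedField_quotient hp5 N₄ _ le_sup_left ϖ hϖ _ hmap₄c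
      (forall_classicalMuVanishes_fixedField_of_le hp5 le_sup_right hμZ)
  have hmap₄d : (N₄ ⊔ (Subgroup.zpowers (a * a) ⊔ Subgroup.zpowers s)).map ϖ = Subgroup.closure {ϖ (a * a), ϖ s} := by
    rw [Subgroup.map_sup, Subgroup.map_sup, MonoidHom.map_zpowers, MonoidHom.map_zpowers, hN₄ϖ, bot_sup_eq, Set.insert_eq,
      Subgroup.closure_union, ← Subgroup.zpowers_eq_closure, ← Subgroup.zpowers_eq_closure]
  have hμ₄d : ∀ κE : ZpExtension ↥(fixedField (Subgroup.closure {ϖ (a * a), ϖ s})) 5,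
      κE.IsCyclotomic → ClassicalMuVanishes κE :=
    forall_classicalMuVanishes_fixedField_quotient hp5 N₄ _ le_sup_left ϖ hϖ _ hmap₄d
      (forall_classicalMuVanishes_fixedField_of_le hp5 (by rw [hN₄]; exact sup_le_sup_left le_sup_right _) hμK)
  have hμA : ∀ κE : ZpExtension ↥(fixedField (Subgroup.zpowers (a * a * (a * a)))) 5,
      κE.IsCyclotomic → ClassicalMuVanishes κE := by
    rw [← hN₄]
    exact classicalMuVanishes_of_isCyclotomic_of_biquadratic (by decide) ↥(fixedField N₄) hp₄ hz₄ hb₄ hzb₄ hμ₄a hμ₄b hμ₄c hμ₄d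
  exact classicalMuVanishes_of_isCyclotomic_of_kuroda_conj (by decide) L hp5 hz hb hzb hconj hμA hμP κL hκL

/-! ### §2 The `ℚ(E[5])`-level form -/

/-- `Γ_ℚ → Gal(ℚ(E[n])/ℚ)` is onto. [folklore] -/
private theorem absRestrictNormalHom_surjective_idx₃ {F : Type*} [Field F] (E : IntermediateField F (AlgebraicClosure F))
    [Normal F E] : Function.Surjective (absRestrictNormalHom E) := fun g => by
  obtain ⟨σ, hσ⟩ := AlgEquiv.restrictNormalHom_surjective (AlgebraicClosure F) g
  exact ⟨(absoluteGaloisGroup.toAlgEquiv F).symm σ, hσ⟩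

/-- Two matrices with the same action on the vectors `e P` are equal. [folklore] -/
private theorem matrix_eq_of_forall_mulVec_idx₃ {A : Type*} [AddCommGroup A] {n : ℕ} (e : A ≃+ (Fin 2 → ZMod n))
    {M N : Matrix (Fin 2) (Fin 2) (ZMod n)} (h : ∀ P : A, M *ᵥ e P = N *ᵥ e P) : M = N :=
  Matrix.toLin'.injective (LinearMap.ext fun v => by
    rw [Matrix.toLin'_apply, Matrix.toLin'_apply, ← e.apply_symm_apply v, h])

/-- `…_splitCartanIndexTwo_five_fixedField_abelian` for any `ℚ`-algebra structure on `L` (all coincide: `Subsingleton (Algebra ℚ L)`).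
[cite: Serre1972, §2.2 (split Cartan subgroups, normalisers)] [cite: Washington1997, §7.5, §13.1] -/
private theorem indexTwo_five_fixedField_alg_abelian [Fact (Nat.Prime 5)]
    (L : Type) [Field L] [NumberField L] [alg : Algebra ℚ L] [IsGalois ℚ L]
    (ρ : (L ≃ₐ[ℚ] L) →* Matrix (Fin 2) (Fin 2) (ZMod 5)) (hρ : Function.Injective ρ)
    (himg : ∀ g, ρ g ∈ splitCartanNormalizer 5 ∧ ((ρ g) 1 1 = (ρ g) 0 0 ∨ (ρ g) 1 1 = 4 * (ρ g) 0 0) ∧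
      ((ρ g) 1 0 = 2 * (ρ g) 0 1 ∨ (ρ g) 1 0 = 3 * (ρ g) 0 1))
    {s a : L ≃ₐ[ℚ] L} (hs : ρ s = !![1, 0; 0, 4]) (ha : ρ a = !![0, 1; 2, 0])
    (hμP : ∀ κE : ZpExtension ↥(fixedField (Subgroup.zpowers s)) 5, κE.IsCyclotomic → ClassicalMuVanishes κE)
    (hμK : ∀ κE : ZpExtension ↥(fixedField (Subgroup.zpowers (a * a * (a * a)) ⊔ Subgroup.zpowers s)) 5,
      κE.IsCyclotomic → ClassicalMuVanishes κE)
    (hμZ : ∀ κE : ZpExtension ↥(fixedField (Subgroup.zpowers (a * a * s))) 5, κE.IsCyclotomic → ClassicalMuVanishes κE)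
    (hμQ : ∀ κE : ZpExtension ↥(fixedField (Subgroup.zpowers a)) 5, κE.IsCyclotomic → ClassicalMuVanishes κE)
    (hμR : ∀ κE : ZpExtension ↥(fixedField (Subgroup.zpowers (a * a) ⊔ Subgroup.zpowers (a * s))) 5,
      κE.IsCyclotomic → ClassicalMuVanishes κE)
    (κL : ZpExtension L 5) (hκL : κL.IsCyclotomic) : ClassicalMuVanishes κL := by
  have h : alg = DivisionRing.toRatAlgebra := Subsingleton.elim _ _
  subst h
  exact classicalMuVanishes_of_isCyclotomic_of_splitCartanIndexTwo_five_fixedField_abelian L ρ hρ himg hs ha hμP hμK hμZ hμQ hμR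
    κL hκL

/-- **`μ = 0` for `ℚ(E[5])_cyc` from a mod-5 image in `G₁₆ = ⟨(0 1; 2 0), diag(1,4)⟩ ≅ M₁₆` — NO named fact: `ℚ(P₁)` plus four abelian leaves.**
`E/ℚ` elliptic; `e` a basis of `E[5]` in which every `σ ∈ Γ_ℚ` acts through a matrix `M ∈ splitCartanNormalizer 5` of shape `c·1`, `c·diag(1,4)`,
`c·(0 1; 2 0)` or `c·(0 1; 3 0)` (`he`); `σ_s, σ_a ∈ Γ_ℚ` acting in the basis `e` as `diag(1,4)` and `(0 1; 2 0)` (they exist when the image is all of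
`G₁₆`).  If `μ = 0` holds for every cyclotomic `ℤ_5`-extension of the fixed fields in `ℚ(E[5])` of `⟨σ̄_s⟩` (`= ℚ(P₁)`, 8), `⟨σ̄_a⁴, σ̄_s⟩` (`K″`: cyclic
quartic `⊇ ℚ(√5)`), `⟨σ̄_a²σ̄_s⟩` (`= ℚ(ζ₅)`, the kernel of `det`), `⟨σ̄_a⟩` and `⟨σ̄_a², σ̄_aσ̄_s⟩` (the two quadratic subfields of `ℚ(E[5])` not inside
`ℚ(P₁)`), then for every cyclotomic `ℤ_5`-extension of `ℚ(E[5])`: the hypothesis of road (b) (`CoatesSujatha2005.thm34_…_holds`) at `p = 5`.  No growth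
theorem, no named fact; Kuroda equalities only (the supports `ℚ(E[5])^{⟨−1⟩}`, `ℚ(E[5])^{⟨−1, σ̄_s⟩}` that g18 took from Ferrero–Washington are
derived from the four abelian leaves).
[cite: Lemmermeyer1994, §1 (Kuroda's class number formula, odd part)] [cite: Washington1997, §7.5, §13.1]
[cite: Serre1972, §2.2 (split Cartan subgroups and their normalisers)] -/
theorem classicalMuVanishes_divisionField_of_splitCartanIndexTwoBasis_five_abelian
    [Fact (Nat.Prime 5)] (W : WeierstrassCurve ℚ) [W.IsElliptic] (e : W.geomTorsion (5 : ℕ) ≃+ (Fin 2 → ZMod 5))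
    (he : ∀ σ : absoluteGaloisGroup ℚ, ∃ M ∈ splitCartanNormalizer 5, (M 1 1 = M 0 0 ∨ M 1 1 = 4 * M 0 0) ∧
      (M 1 0 = 2 * M 0 1 ∨ M 1 0 = 3 * M 0 1) ∧ ∀ P : W.geomTorsion (5 : ℕ), e (σ • P) = M *ᵥ e P)
    (σs σa : absoluteGaloisGroup ℚ) (hσs : ∀ P : W.geomTorsion (5 : ℕ), e (σs • P) = !![1, 0; 0, 4] *ᵥ e P)
    (hσa : ∀ P : W.geomTorsion (5 : ℕ), e (σa • P) = !![0, 1; 2, 0] *ᵥ e P)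
    (hμP : haveI : NumberField ↥(W.divisionField 5) := NumberField.mk
      ∀ κE : ZpExtension ↥(fixedField (Subgroup.zpowers (absRestrictNormalHom (W.divisionField 5) σs))) 5,
        κE.IsCyclotomic → ClassicalMuVanishes κE)
    (hμK : haveI : NumberField ↥(W.divisionField 5) := NumberField.mk
      ∀ κE : ZpExtension ↥(fixedField (Subgroup.zpowers (absRestrictNormalHom (W.divisionField 5) σa * absRestrictNormalHom (W.divisionField 5) σa *
        (absRestrictNormalHom (W.divisionField 5) σa * absRestrictNormalHom (W.divisionField 5) σa)) ⊔ Subgroup.zpowers (absRestrictNormalHom (W.divisionField 5) σs))) 5,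
        κE.IsCyclotomic → ClassicalMuVanishes κE)
    (hμZ : haveI : NumberField ↥(W.divisionField 5) := NumberField.mk
      ∀ κE : ZpExtension ↥(fixedField (Subgroup.zpowers (absRestrictNormalHom (W.divisionField 5) σa * absRestrictNormalHom (W.divisionField 5) σa *
        absRestrictNormalHom (W.divisionField 5) σs))) 5, κE.IsCyclotomic → ClassicalMuVanishes κE)
    (hμQ : haveI : NumberField ↥(W.divisionField 5) := NumberField.mk
      ∀ κE : ZpExtension ↥(fixedField (Subgroup.zpowers (absRestrictNormalHom (W.divisionField 5) σa))) 5,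
        κE.IsCyclotomic → ClassicalMuVanishes κE)
    (hμR : haveI : NumberField ↥(W.divisionField 5) := NumberField.mk
      ∀ κE : ZpExtension ↥(fixedField (Subgroup.zpowers (absRestrictNormalHom (W.divisionField 5) σa * absRestrictNormalHom (W.divisionField 5) σa) ⊔
        Subgroup.zpowers (absRestrictNormalHom (W.divisionField 5) σa * absRestrictNormalHom (W.divisionField 5) σs))) 5,
        κE.IsCyclotomic → ClassicalMuVanishes κE) :
    haveI : NumberField ↥(W.divisionField 5) := NumberField.mk
    ∀ κL : ZpExtension ↥(W.divisionField 5) 5, κL.IsCyclotomic → ClassicalMuVanishes κL := by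
  haveI : NumberField ↥(W.divisionField 5) := NumberField.mk
  intro κL hκL
  obtain ⟨ρ, hρ, hρe⟩ := exists_matrixRep_divisionField W 5 e
  have hπ := absRestrictNormalHom_surjective_idx₃ (W.divisionField 5)
  have hmat : ∀ (σ : absoluteGaloisGroup ℚ) (M : Matrix (Fin 2) (Fin 2) (ZMod 5)),
      (∀ P : W.geomTorsion (5 : ℕ), e (σ • P) = M *ᵥ e P) → ρ (absRestrictNormalHom (W.divisionField 5) σ) = M :=
    fun σ M hM => matrix_eq_of_forall_mulVec_idx₃ e fun P => by rw [← hρe, hM]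
  have himg' : ∀ g, ρ g ∈ splitCartanNormalizer 5 ∧ ((ρ g) 1 1 = (ρ g) 0 0 ∨ (ρ g) 1 1 = 4 * (ρ g) 0 0) ∧
      ((ρ g) 1 0 = 2 * (ρ g) 0 1 ∨ (ρ g) 1 0 = 3 * (ρ g) 0 1) := fun g => by
    obtain ⟨σ, rfl⟩ := hπ g
    obtain ⟨M, hM, hMd, hMa, hMe⟩ := he σ
    rw [hmat σ M hMe]
    exact ⟨hM, hMd, hMa⟩
  exact @indexTwo_five_fixedField_alg_abelian _ ↥(W.divisionField 5) _ _ (_) (W.isGalois_divisionField 5) ρ hρ himg' _ _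
    (hmat σs _ hσs) (hmat σa _ hσa) hμP hμK hμZ hμQ hμR κL hκL

end Literature.NumberTheory.IwasawaTheory

end
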